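import Literature.MathematicalPhysics.QuantumFieldTheory.Balaban1983to89.B9Thm37Sum

/-!
# B9Thm37GlueQ — the averaging line of (3.88): the commutator [M_{h_□}, Q′*aQ′] has the block majorant
(oscillation of h_□) × (majorant of Q′*aQ′) (sibling leaf of the `B9Thm37Glue` lineage; cell record D-pv21g6.4)

[B9] T. Bałaban, *Propagators for lattice gauge theories in a background field*, Commun. Math. Phys. **99** (1985)
389–434 [cite: Balaban1985BackgroundPropagators]; [4] = T. Bałaban, *Propagators and renormalization transformations
for lattice gauge theories. II*, Commun. Math. Phys. **96** (1984) 223–250 [cite: Balaban1984PropagatorsII].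

p. 394 (verbatim, render p006-x2): *"Let us introduce the operator Δ′_a = Δ′_a(U) = (Δ^η_U + Q′*aQ′)↾_{Ω₀}, where
Q′*aQ′ is defined by the same quadratic form as in (2.14), i.e. ⟨λ, Q′*aQ′λ⟩ = Σ_{j=0}^k a_j Σ_{y∈Λ_j}
(L^jη)^{d−2}|(Q′_j(U)λ)(y)|², (3.24)"*.  p. 409, (3.88) with its
SECOND display line (verbatim; render p021-x2 read as image, as certified in the header of `B9Thm37Sum` v1.1):
*"Using (3.50) we get for x∈Δ(y), y∈Λ_j, (Δ′_ahλ)(x) = h(x)(Δ′_aλ)(x) − Σ_{b∈st(x)}(∂h)(b)(Dλ)(b) + (Δh)(x)λ(x)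
+ a_j(L^jη)^{−2} Σ_{x′∈B^j(y)} L^{−jd}(∂h)(Γ^{(j)}_{x,y} ∪ Γ^{(j)}_{y,x′})R((U(Γ^{(j)}_{y,x}))^{−1}R(U(Γ^{(j)}_{y,x′}))λ(x′)
= h(x)(Δ′_aλ)(x) − (K(h)λ)(x), (3.88)"*; [4] p. 230, (2.40), third term (verbatim, render p008-x2):
*"− a_j Σ_{x′∈B^j(y^j(x))} L^{−jd}(∂^{L^{−j}}h_□)(Γ^{(j)}_{x,y^j(x),x′})(G′(□)h_□λ)(x′)"*.

THE POINT.  In Δ′_a(hλ) − hΔ′_aλ the averaging part Q := Q′*aQ′ of Δ′_a contributes the COMMUTATOR (M_hQ − QM_h)λ,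
whose matrix is (h(x) − h(x′))·Q(x, x′) — our READING of print's second line of (3.88) (cell record D-pv21g6.4:
η·(∂h) summed along the contour Γ^{(j)}_{x,y} ∪ Γ^{(j)}_{y,x′} from x to x′ telescopes to the difference of h at its
ends; a_j(L^jη)^{−2}L^{−jd}R(·)^{−1}R(·) is the matrix of Q′*aQ′ inside the block B^j(y); neither is typed here).  The lineage `B9Thm37Glue` v7 / `B9Thm37GlueT` / `B9Thm37GlueSt` keeps Q
ABSTRACT and carries the commutator's block majorant as the HYPOTHESIS `hQ : HasMajorant blk (M_{h_□}Q − QM_{h_□})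
K_{Q,□}` with located row / column sums κ_Q·1_{S′_□} (`hrowQ`, `hcolQ`).  THIS FILE derives that hypothesis from two
pieces of pointwise data: a block majorant K of Q itself (print: Q′*aQ′ couples only points of one averaging block
B^j(y) = Δ(y), with Σ_{x′}|Q(x,x′)| ≦ O(1)·a_j(L^jη)^{−2} — the quadratic form (3.24), NOT typed here) and the OSCILLATION of
h_□ across coupled pairs, |h_□(x) − h_□(x′)| ≦ ω_□(y, y′) whenever Q(x, x′) ≠ 0, x∈Δ(y), x′∈Δ(y′) (print: h_□ varies
on the scale ML^jη and coupled points are within L^jη, so ω_□ = O(M^{−1}), located on the blocks meeting supp ∇h_□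
— NOT asserted): then M_{h_□}Q − QM_{h_□} has the block majorant ω_□·K (`hasMajorant_comm_mulOp`), and the located
row / column sums follow from those of K (`rowSum_comm_le`, `colSum_comm_le`).  On the way the file records the
folklore identification behind every `HasMajorant` statement of the cell: an operator T on the finite function
space has the block majorant K iff the block-ℓ¹ norms of the rows of its MATRIX are bounded by K
(`rowBlockSum_le_of_hasMajorant`, `hasMajorant_of_rowBlockSum_le`).

CONTENTS.  §1 matrix entries `ent T x x′` = T(δ_{x′})(x) of an endomorphism of X → ℝ (X finite) and `apply_eq_sum_ent`;
§2 `HasMajorant` ⟺ row block sums of |ent| ≦ K; §3 the commutator majorant `hasMajorant_comm_mulOp` and its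
component version `hasMajorant_comm_mulOp_fst` (X = St × Cp, h∘Prod.fst — the shape of `hQ` in the lineage);
§4 located row / column sums and localisation of ω·K (`rowSum_comm_le`, `colSum_comm_le`, `comm_loc`); §5 the
bundled `commData_of_osc`.  v2 (append-only before the namespace end): §6 the STRUCTURE of print's Q′*aQ′ —
`conjOp A D` = Q′ᵀDQ′ with matrix Σ_y A(y, x)D(y)A(y, x′) (`ent_conjOp`), symmetric for the component pairing
(`conjOp_symm` = the hypothesis `hQt` of the entry-3 theorems, unfolded), and block-DIAGONAL majorant
1_{a=b}·d(a)c(a)r(a) when every averaging site reads one block (`hasMajorant_conjOp`: |D| ≦ d, row / column ℓ¹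
bounds r, c of A = Q′ — binders; print's Q′_j(U) of (3.18)–(3.19), p. 393, is not typed); §7 `commData_of_conj` (the five
Q-hypotheses of the lineage for Q = Q′ᵀDQ′, κ_Q := ω₀k with d(a)c(a)r(a)(L^{j_a}η)² ≦ k — print O(a_j), NOT asserted).
v3 (append-only): §8 block reads ⇒ Q(x, x′) ≠ 0 only within ONE block (`blk_eq_of_ent_conjOp_ne`), so the
oscillation hypothesis `hω` follows from a WITHIN-BLOCK oscillation bound o_□ of h_□ with the diagonal
ω_□(a, b) = 1_{a=b}o_□(a) (`osc_of_blockReads`); §9 `commData_of_conj_osc` (the five Q-hypotheses from block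
reads, d, r, c, k and o_□ ∈ [0, ω₀] located on S′_□ — all binders; print's o_□ = O(M^{−1}) NOT asserted).
v4 (append-only): §10 o_□ from a per-bond difference bound θ of h_□ telescoped along chains of ≦ P bonds inside a
block (`Linked`, `abs_sub_le_of_linked`, `eq_of_linked`, `osc_of_linked`: o_□(a) = 1_{a∈S′_□}Pθ); §11 the ℓ¹
sizes r, c of A = Q′ from a pointwise bound |A(y, x)| ≦ w(β y), block reads and block cardinalities n_X, n_Y
(`rowSum_le_of_pointwise`, `colSum_le_of_pointwise`) — θ, P, connectivity, w, n_X, n_Y all binders.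

NOT ASSERTED: the majorant K of Q′*aQ′ and its sizes (hypothesis `hT`/`hK…`; in §6–§9 the block reads `hread` and
the bounds d, r, c, k of A = Q′ and D; in §10–§11 θ, P, `hconn`, `hsupp`, w, n_X, n_Y), the oscillation bound ω_□ /
o_□ and its location / size (hypotheses `hω`, `hosc`, `hoS`, `hob`), everything else of the lineage.  Value: kernel-checked bookkeeping (the second
line of (3.88) as a commutator majorant), NOT summit progress.
-/

namespace Literature.MathematicalPhysics.QuantumFieldTheory.Balaban1983to89.B9Thm37GlueQ

open Literature.MathematicalPhysics.QuantumFieldTheory.Balaban1983to89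
open Finset B6RandomWalk B9Thm37Sum B9Thm34Ext

variable {G : B6.Geometry} [DecidableEq G.Site] {X : Type} [Fintype X] [DecidableEq X]

/-! ## §1  Matrix entries of an endomorphism of the finite function space -/

section Entries

/-- MODEL. The matrix entry T(x, x′) := (Tδ_{x′})(x) of an endomorphism T of X → ℝ. [folklore] -/
def ent (T : Module.End ℝ (X → ℝ)) (x x' : X) : ℝ :=
  T (fun j => if x' = j then (1 : ℝ) else 0) x

omit [DecidableEq G.Site] in
/-- (Tf)(x) = Σ_{x′} T(x, x′) f(x′). [folklore] -/
theorem apply_eq_sum_ent (T : Module.End ℝ (X → ℝ)) (f : X → ℝ) (x : X) :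
    T f x = ∑ x', ent T x x' * f x' := by
  conv_lhs => rw [pi_eq_sum_univ f]
  rw [map_sum, Finset.sum_apply]
  refine Finset.sum_congr rfl fun x' _ => ?_
  rw [map_smul, Pi.smul_apply, smul_eq_mul, mul_comm]
  rfl

omit [DecidableEq G.Site] [Fintype X] in
/-- Matrix entries of the commutator with a multiplication operator: (M_hT − TM_h)(x, x′) = (h(x) − h(x′))T(x, x′).
[cite: Balaban1985BackgroundPropagators, (3.88) p.409 (second display line)] -/
theorem ent_comm_mulOp (T : Module.End ℝ (X → ℝ)) (h : X → ℝ) (x x' : X) :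
    ent (mulOp h * T - T * mulOp h) x x' = (h x - h x') * ent T x x' := by
  unfold ent
  rw [LinearMap.sub_apply, Pi.sub_apply, Module.End.mul_apply, Module.End.mul_apply, mulOp_apply]
  have hm : mulOp h (fun j => if x' = j then (1 : ℝ) else 0) = h x' • fun j => if x' = j then (1 : ℝ) else 0 := by
    funext j
    rw [mulOp_apply, Pi.smul_apply, smul_eq_mul]
    by_cases hj : x' = j
    · rw [hj]
    · rw [if_neg hj, mul_zero, mul_zero]
  rw [hm, map_smul, Pi.smul_apply, smul_eq_mul]
  ring

end Entries

/-! ## §2  Block majorants = bounds on the block-ℓ¹ norms of the rows of the matrix -/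

section RowBlockSums

/-- **A block majorant bounds the block-ℓ¹ norms of the rows** (test (2.51) with λ = the sign pattern of the row on
the block Δ(y′)). [cite: Balaban1984PropagatorsII, (2.51) p.232] -/
theorem rowBlockSum_le_of_hasMajorant (blk : X → G.Site) {T : Module.End ℝ (X → ℝ)} {K : G.Site → G.Site → ℝ}
    (hT : HasMajorant blk T K) (x : X) (y' : G.Site) :
    ∑ x' ∈ Finset.univ.filter (fun x' => blk x' = y'), |ent T x x'| ≤ K (blk x) y' := by
  have hμ : BlockSupp blk (fun x' => if blk x' = y' then (if 0 ≤ ent T x x' then (1 : ℝ) else -1) else 0) y' 1 := by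
    refine ⟨zero_le_one, fun x' hx' => ?_, fun x' hx' => ?_⟩
    · rw [if_pos hx']
      by_cases he : 0 ≤ ent T x x'
      · rw [if_pos he, abs_one]
      · rw [if_neg he, abs_neg, abs_one]
    · rw [if_neg hx']
  have hb := hT y' _ 1 hμ x
  rw [mul_one] at hb
  have hsum : T (fun x' => if blk x' = y' then (if 0 ≤ ent T x x' then (1 : ℝ) else -1) else 0) x
      = ∑ x' ∈ Finset.univ.filter (fun x' => blk x' = y'), |ent T x x'| := by
    rw [apply_eq_sum_ent, ← Finset.sum_filter_add_sum_filter_not Finset.univ (fun x' => blk x' = y')]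
    have hz : ∑ x' ∈ Finset.univ.filter (fun x' => ¬blk x' = y'),
        ent T x x' * (if blk x' = y' then (if 0 ≤ ent T x x' then (1 : ℝ) else -1) else 0) = 0 :=
      Finset.sum_eq_zero fun x' hx' => by
        simp only [Finset.mem_filter, Finset.mem_univ, true_and] at hx'
        rw [if_neg hx', mul_zero]
    rw [hz, add_zero]
    refine Finset.sum_congr rfl fun x' hx' => ?_
    simp only [Finset.mem_filter, Finset.mem_univ, true_and] at hx'
    rw [if_pos hx']
    by_cases he : 0 ≤ ent T x x'
    · rw [if_pos he, mul_one, abs_of_nonneg he]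
    · rw [if_neg he, mul_neg_one, abs_of_neg (lt_of_not_ge he)]
  rw [← hsum]
  exact (le_abs_self _).trans hb

/-- **Conversely, row block-ℓ¹ bounds give the block majorant.** [cite: Balaban1984PropagatorsII, (2.51) p.232] -/
theorem hasMajorant_of_rowBlockSum_le (blk : X → G.Site) {T : Module.End ℝ (X → ℝ)} {K : G.Site → G.Site → ℝ}
    (h : ∀ (x : X) (y' : G.Site), ∑ x' ∈ Finset.univ.filter (fun x' => blk x' = y'), |ent T x x'| ≤ K (blk x) y') :
    HasMajorant blk T K := by
  intro y' μ B hμ x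
  rw [apply_eq_sum_ent]
  calc |∑ x', ent T x x' * μ x'| ≤ ∑ x', |ent T x x' * μ x'| := Finset.abs_sum_le_sum_abs _ _
    _ = ∑ x' ∈ Finset.univ.filter (fun x' => blk x' = y'), |ent T x x' * μ x'| := by
        rw [← Finset.sum_filter_add_sum_filter_not Finset.univ (fun x' => blk x' = y')]
        have hz : ∑ x' ∈ Finset.univ.filter (fun x' => ¬blk x' = y'), |ent T x x' * μ x'| = 0 :=
          Finset.sum_eq_zero fun x' hx' => by
            simp only [Finset.mem_filter, Finset.mem_univ, true_and] at hx'
            rw [hμ.off x' hx', mul_zero, abs_zero]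
        rw [hz, add_zero]
    _ ≤ ∑ x' ∈ Finset.univ.filter (fun x' => blk x' = y'), |ent T x x'| * B := by
        refine Finset.sum_le_sum fun x' hx' => ?_
        simp only [Finset.mem_filter, Finset.mem_univ, true_and] at hx'
        rw [abs_mul]
        exact mul_le_mul_of_nonneg_left (hμ.bound x' hx') (abs_nonneg _)
    _ = (∑ x' ∈ Finset.univ.filter (fun x' => blk x' = y'), |ent T x x'|) * B := by rw [Finset.sum_mul]
    _ ≤ K (blk x) y' * B := mul_le_mul_of_nonneg_right (h x y') hμ.nonneg

/-- A block majorant is nonnegative on every pair (y, y′) with y in the image of the block map. [folklore] -/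
theorem majorant_nonneg_of_hasMajorant (blk : X → G.Site) {T : Module.End ℝ (X → ℝ)} {K : G.Site → G.Site → ℝ}
    (hT : HasMajorant blk T K) (x : X) (y' : G.Site) : 0 ≤ K (blk x) y' :=
  (Finset.sum_nonneg fun _ _ => abs_nonneg _).trans (rowBlockSum_le_of_hasMajorant blk hT x y')

end RowBlockSums

/-! ## §3  The commutator [M_h, Q] -/

section Commutator

/-- **The averaging line of (3.88) as a block majorant**: if Q has the block majorant K and h oscillates by at most
ω(y, y′) across every pair (x, x′) coupled by Q (x∈Δ(y), x′∈Δ(y′), Q(x, x′) ≠ 0), then M_hQ − QM_h — matrix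
(h(x) − h(x′))Q(x, x′) — has the block majorant ω·K.
[cite: Balaban1985BackgroundPropagators, (3.88) p.409 (second display line); Balaban1984PropagatorsII, (2.40) p.230 (third term)] -/
theorem hasMajorant_comm_mulOp (blk : X → G.Site) {T : Module.End ℝ (X → ℝ)} {K : G.Site → G.Site → ℝ}
    (hT : HasMajorant blk T K) (h : X → ℝ) (ω : G.Site → G.Site → ℝ) (hω0 : ∀ a b, 0 ≤ ω a b)
    (hω : ∀ x x', ent T x x' ≠ 0 → |h x - h x'| ≤ ω (blk x) (blk x')) :
    HasMajorant blk (mulOp h * T - T * mulOp h) (fun a b => ω a b * K a b) := by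
  refine hasMajorant_of_rowBlockSum_le blk fun x y' => ?_
  calc ∑ x' ∈ Finset.univ.filter (fun x' => blk x' = y'), |ent (mulOp h * T - T * mulOp h) x x'|
      ≤ ∑ x' ∈ Finset.univ.filter (fun x' => blk x' = y'), ω (blk x) y' * |ent T x x'| := by
        refine Finset.sum_le_sum fun x' hx' => ?_
        simp only [Finset.mem_filter, Finset.mem_univ, true_and] at hx'
        rw [ent_comm_mulOp, abs_mul]
        by_cases he : ent T x x' = 0
        · rw [he, abs_zero, mul_zero, mul_zero]
        · rw [← hx']
          exact mul_le_mul_of_nonneg_right (hω x x' he) (abs_nonneg _)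
    _ = ω (blk x) y' * ∑ x' ∈ Finset.univ.filter (fun x' => blk x' = y'), |ent T x x'| := by rw [Finset.mul_sum]
    _ ≤ ω (blk x) y' * K (blk x) y' :=
        mul_le_mul_of_nonneg_left (rowBlockSum_le_of_hasMajorant blk hT x y') (hω0 _ _)

/-- **Component version** (the shape of `hQ` in `B9Thm37Glue` v7 / `B9Thm37GlueT` / `B9Thm37GlueSt`): X = St × Cp,
h = h_□ ∘ Prod.fst. [cite: Balaban1985BackgroundPropagators, (3.88) p.409 (second display line)] -/
theorem hasMajorant_comm_mulOp_fst {St Cp : Type} [Fintype St] [Fintype Cp] [DecidableEq St] [DecidableEq Cp]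
    (blk : St × Cp → G.Site) {Qf : Module.End ℝ (St × Cp → ℝ)} {K : G.Site → G.Site → ℝ}
    (hT : HasMajorant blk Qf K) (hs : St → ℝ) (ω : G.Site → G.Site → ℝ) (hω0 : ∀ a b, 0 ≤ ω a b)
    (hω : ∀ p q : St × Cp, ent Qf p q ≠ 0 → |hs p.1 - hs q.1| ≤ ω (blk p) (blk q)) :
    HasMajorant blk (mulOp (hs ∘ Prod.fst) * Qf - Qf * mulOp (hs ∘ Prod.fst)) (fun a b => ω a b * K a b) :=
  hasMajorant_comm_mulOp blk hT (hs ∘ Prod.fst) ω hω0 fun p q hpq => hω p q hpq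

end Commutator

/-! ## §4  Located row / column sums and localisation of ω·K -/

section Located

variable {Site : Type} [Fintype Site] [DecidableEq Site]

omit [Fintype Site] [DecidableEq Site] in
/-- Localisation of ω·K within the radius of K. [folklore] -/
theorem comm_loc {ω K : Site → Site → ℝ} {dist : Site → Site → ℝ} {ρ : ℝ}
    (hloc : ∀ a b, K a b ≠ 0 → dist a b ≤ ρ) (a b : Site) (h : ω a b * K a b ≠ 0) : dist a b ≤ ρ :=
  hloc a b (mul_ne_zero_iff.mp h).2

/-- **Located row sums** (the `hrowQ` shape): if ω(a, ·) ≦ ω₀·1_{S′}(a) and the rows of K against the weight W sum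
to at most k, then the rows of ω·K against W sum to at most ω₀k·1_{S′}(a). [folklore] -/
theorem rowSum_comm_le {ω K : Site → Site → ℝ} {W : Site → ℝ} (S' : Finset Site) {ω₀ k : ℝ}
    (hK : ∀ a b, 0 ≤ K a b) (hW : ∀ b, 0 ≤ W b) (hω0 : ∀ a b, 0 ≤ ω a b)
    (hωS : ∀ a b, ω a b ≤ if a ∈ S' then ω₀ else 0) (hrow : ∀ a, ∑ b, K a b * W b ≤ k) (a : Site) :
    ∑ b, ω a b * K a b * W b ≤ if a ∈ S' then ω₀ * k else 0 := by
  by_cases ha : a ∈ S'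
  · rw [if_pos ha]
    have hω0' : 0 ≤ ω₀ := by
      have := (hω0 a a).trans (hωS a a)
      rwa [if_pos ha] at this
    calc ∑ b, ω a b * K a b * W b ≤ ∑ b, ω₀ * (K a b * W b) := by
          refine Finset.sum_le_sum fun b _ => ?_
          rw [mul_assoc]
          have hb := hωS a b
          rw [if_pos ha] at hb
          exact mul_le_mul_of_nonneg_right hb (mul_nonneg (hK a b) (hW b))
      _ = ω₀ * ∑ b, K a b * W b := by rw [Finset.mul_sum]
      _ ≤ ω₀ * k := mul_le_mul_of_nonneg_left (hrow a) hω0'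
  · rw [if_neg ha]
    refine Finset.sum_nonpos fun b _ => ?_
    have hb := hωS a b
    rw [if_neg ha] at hb
    have h0 : ω a b = 0 := le_antisymm hb (hω0 a b)
    rw [h0, zero_mul, zero_mul]

/-- **Located column sums** (the `hcolQ` shape): if ω(·, b) ≦ ω₀·1_{S′}(b) and the columns of K times the weight
W(b) are at most k, then so are those of ω·K, times ω₀·1_{S′}(b). [folklore] -/
theorem colSum_comm_le {ω K : Site → Site → ℝ} {W : Site → ℝ} (S' : Finset Site) {ω₀ k : ℝ}
    (hK : ∀ a b, 0 ≤ K a b) (hW : ∀ b, 0 ≤ W b) (hω0 : ∀ a b, 0 ≤ ω a b)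
    (hωS : ∀ a b, ω a b ≤ if b ∈ S' then ω₀ else 0) (hcol : ∀ b, (∑ a, K a b) * W b ≤ k) (b : Site) :
    (∑ a, ω a b * K a b) * W b ≤ if b ∈ S' then ω₀ * k else 0 := by
  by_cases hb : b ∈ S'
  · rw [if_pos hb]
    have hω0' : 0 ≤ ω₀ := by
      have := (hω0 b b).trans (hωS b b)
      rwa [if_pos hb] at this
    calc (∑ a, ω a b * K a b) * W b ≤ (∑ a, ω₀ * K a b) * W b := by
          refine mul_le_mul_of_nonneg_right (Finset.sum_le_sum fun a _ => ?_) (hW b)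
          have ha := hωS a b
          rw [if_pos hb] at ha
          exact mul_le_mul_of_nonneg_right ha (hK a b)
      _ = ω₀ * ((∑ a, K a b) * W b) := by rw [← Finset.mul_sum, mul_assoc]
      _ ≤ ω₀ * k := mul_le_mul_of_nonneg_left (hcol b) hω0'
  · rw [if_neg hb]
    have h0 : ∀ a, ω a b = 0 := fun a => by
      have ha := hωS a b
      rw [if_neg hb] at ha
      exact le_antisymm ha (hω0 a b)
    have hz : ∑ a, ω a b * K a b = 0 := Finset.sum_eq_zero fun a _ => by rw [h0 a, zero_mul]
    rw [hz, zero_mul]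

end Located

/-! ## §5  Bundled: the five Q-hypotheses of the lineage from a majorant of Q and the oscillation of h_□ -/

section Bundled

variable {g : B9.Geometry} [Fintype g.Site] [DecidableEq g.Site] {R : ℝ} {H : Prop}
  {St Cp ι : Type} [Fintype St] [Fintype Cp] [DecidableEq St] [DecidableEq Cp]

/-- **The Q-data of `B9Thm37Glue` v7 / `B9Thm37GlueT` / `B9Thm37GlueSt` (`hQ`, `hKQ`, `hlocQ`, `hrowQ`, `hcolQ`, with
K_{Q,□} := ω_□·K and κ_Q := ω₀k) from: a block majorant K ≧ 0 of Q := Q′*aQ′ of range ρ whose rows and columns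
against (L^jη)² = `g.len ·^2` are at most k, and per cube □ = i an oscillation bound ω_□ ≦ ω₀ of h_□ across the
pairs coupled by Q, vanishing unless both blocks lie in S′_□.  Print: K diagonal in the blocks Δ(y) = B^j(y) with
k = O(a_j) = O(1) (the quadratic form (3.24) p. 394, not typed), ω₀ = O(M^{−1}) (h_□ of [4] Sect. A varies on scale ML^jη) — NOT
asserted. [cite: Balaban1985BackgroundPropagators, (3.88) p.409 (second display line); Balaban1984PropagatorsII, (2.40)-(2.44) p.230] -/
theorem commData_of_osc (blk : St × Cp → g.Site) (Qf : Module.End ℝ (St × Cp → ℝ)) (K : g.Site → g.Site → ℝ)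
    (hT : HasMajorant (g := toB6 g R H) blk Qf K) (hK : ∀ a b, 0 ≤ K a b) (ρ : ℝ)
    (hloc : ∀ a b, K a b ≠ 0 → g.dist a b ≤ ρ) (k : ℝ)
    (hrow : ∀ a : g.Site, ∑ b : g.Site, K a b * g.len b ^ 2 ≤ k)
    (hcol : ∀ b : g.Site, (∑ a : g.Site, K a b) * g.len b ^ 2 ≤ k)
    (hs : ι → St → ℝ) (S' : ι → Finset g.Site) (ω : ι → g.Site → g.Site → ℝ) (ω₀ : ℝ)
    (hω0 : ∀ i a b, 0 ≤ ω i a b) (hωb : ∀ i a b, ω i a b ≤ ω₀)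
    (hωS : ∀ i a b, ω i a b ≠ 0 → a ∈ S' i ∧ b ∈ S' i)
    (hω : ∀ i (p q : St × Cp), ent Qf p q ≠ 0 → |hs i p.1 - hs i q.1| ≤ ω i (blk p) (blk q)) :
    (∀ i, HasMajorant (g := toB6 g R H) blk (mulOp (hs i ∘ Prod.fst) * Qf - Qf * mulOp (hs i ∘ Prod.fst))
        (fun a b => ω i a b * K a b))
    ∧ (∀ i a b, 0 ≤ ω i a b * K a b)
    ∧ (∀ i a y'', ω i a y'' * K a y'' ≠ 0 → g.dist a y'' ≤ ρ)
    ∧ (∀ i (a : g.Site), ∑ y'' : g.Site, ω i a y'' * K a y'' * g.len y'' ^ 2 ≤ if a ∈ S' i then ω₀ * k else 0)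
    ∧ (∀ i (b : g.Site), (∑ y'' : g.Site, ω i y'' b * K y'' b) * g.len b ^ 2 ≤ if b ∈ S' i then ω₀ * k else 0) := by
  have hωrow : ∀ i a b, ω i a b ≤ if a ∈ S' i then ω₀ else 0 := fun i a b => by
    by_cases ha : a ∈ S' i
    · rw [if_pos ha]
      exact hωb i a b
    · rw [if_neg ha]
      by_cases hz : ω i a b = 0
      · rw [hz]
      · exact absurd (hωS i a b hz).1 ha
  have hωcol : ∀ i a b, ω i a b ≤ if b ∈ S' i then ω₀ else 0 := fun i a b => by
    by_cases hb : b ∈ S' i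
    · rw [if_pos hb]
      exact hωb i a b
    · rw [if_neg hb]
      by_cases hz : ω i a b = 0
      · rw [hz]
      · exact absurd (hωS i a b hz).2 hb
  haveI : DecidableEq (toB6 g R H).Site := inferInstanceAs (DecidableEq g.Site)
  refine ⟨fun i => hasMajorant_comm_mulOp_fst (G := toB6 g R H) blk hT (hs i) (ω i) (hω0 i) (hω i),
    fun i a b => mul_nonneg (hω0 i a b) (hK a b), fun i a b hab => comm_loc hloc a b hab,
    fun i a => rowSum_comm_le (S' i) hK (fun b => sq_nonneg (g.len b)) (hω0 i) (hωrow i) hrow a,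
    fun i b => colSum_comm_le (S' i) hK (fun b => sq_nonneg (g.len b)) (hω0 i) (hωcol i) hcol b⟩

end Bundled

/-! ## §6  Q = Q′ᵀDQ′ with block reads: symmetric, block-diagonal majorant (the shape of print's Q′*aQ′) -/

section Conj

variable {Y : Type} [Fintype Y]

/-- MODEL. Matrix entries A(y, x) := (Aδ_x)(y) of a linear map between finite function spaces. [folklore] -/
def entXY (A : (X → ℝ) →ₗ[ℝ] (Y → ℝ)) (y : Y) (x : X) : ℝ :=
  A (fun j => if x = j then (1 : ℝ) else 0) y

omit [DecidableEq G.Site] [Fintype Y] in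
/-- (Af)(y) = Σ_x A(y, x) f(x). [folklore] -/
theorem applyXY_eq_sum (A : (X → ℝ) →ₗ[ℝ] (Y → ℝ)) (f : X → ℝ) (y : Y) :
    A f y = ∑ x, entXY A y x * f x := by
  conv_lhs => rw [pi_eq_sum_univ f]
  rw [map_sum, Finset.sum_apply]
  refine Finset.sum_congr rfl fun x _ => ?_
  rw [map_smul, Pi.smul_apply, smul_eq_mul, mul_comm]
  rfl

/-- MODEL. **Q′ᵀDQ′** — the operator with matrix Σ_y A(y, x)D(y)A(y, x′) (print: Q′*aQ′ of (3.24), A = Q′ = the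
averaging operators Q′_j(U), D = the weights a_j(L^jη)^{d−2} of the quadratic form; neither typed in the cell).
[cite: Balaban1985BackgroundPropagators, (3.24) p.394] -/
noncomputable def conjOp (A : (X → ℝ) →ₗ[ℝ] (Y → ℝ)) (D : Y → ℝ) : Module.End ℝ (X → ℝ) where
  toFun f := fun x => ∑ y, entXY A y x * (D y * A f y)
  map_add' f f' := by
    funext x
    simp only [map_add, Pi.add_apply]
    rw [← Finset.sum_add_distrib]
    exact Finset.sum_congr rfl fun y _ => by ring
  map_smul' r f := by
    funext x
    simp only [map_smul, Pi.smul_apply, smul_eq_mul, RingHom.id_apply]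
    rw [Finset.mul_sum]
    exact Finset.sum_congr rfl fun y _ => by ring

omit [DecidableEq G.Site] [Fintype X] in
/-- Unfolding equation of `conjOp`. [folklore] -/
theorem conjOp_apply (A : (X → ℝ) →ₗ[ℝ] (Y → ℝ)) (D : Y → ℝ) (f : X → ℝ) (x : X) :
    conjOp A D f x = ∑ y, entXY A y x * (D y * A f y) := rfl

omit [DecidableEq G.Site] in
/-- **Q′ᵀDQ′ is symmetric** for the component pairing: Σ_x (Qu)(x)v(x) = Σ_x u(x)(Qv)(x) — literally
`B9Thm37Glue.IsTransposePair Q Q` (the hypothesis `hQt` of the entry-3 theorems of `B9Thm37GlueSt`), stated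
unfolded since this leaf does not import `B9Thm37Glue`. [cite: Balaban1985BackgroundPropagators, (3.24) p.394] -/
theorem conjOp_symm (A : (X → ℝ) →ₗ[ℝ] (Y → ℝ)) (D : Y → ℝ) (u v : X → ℝ) :
    ∑ x, conjOp A D u x * v x = ∑ x, u x * conjOp A D v x := by
  have h : ∀ w w' : X → ℝ, ∑ x, conjOp A D w x * w' x = ∑ y, D y * A w y * A w' y := fun w w' => by
    calc ∑ x, conjOp A D w x * w' x = ∑ x, ∑ y, entXY A y x * (D y * A w y) * w' x := by
          refine Finset.sum_congr rfl fun x _ => ?_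
          rw [conjOp_apply, Finset.sum_mul]
      _ = ∑ y, ∑ x, entXY A y x * (D y * A w y) * w' x := Finset.sum_comm
      _ = ∑ y, D y * A w y * A w' y := by
          refine Finset.sum_congr rfl fun y _ => ?_
          rw [applyXY_eq_sum A w' y, Finset.mul_sum]
          exact Finset.sum_congr rfl fun x _ => by ring
  rw [h u v]
  calc ∑ y, D y * A u y * A v y = ∑ y, D y * A v y * A u y := Finset.sum_congr rfl fun y _ => by ring
    _ = ∑ x, conjOp A D v x * u x := (h v u).symm
    _ = ∑ x, u x * conjOp A D v x := Finset.sum_congr rfl fun x _ => mul_comm _ _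

omit [DecidableEq G.Site] [Fintype X] in
/-- Matrix of Q′ᵀDQ′: Q(x, x′) = Σ_y A(y, x)D(y)A(y, x′). [folklore] -/
theorem ent_conjOp (A : (X → ℝ) →ₗ[ℝ] (Y → ℝ)) (D : Y → ℝ) (x x' : X) :
    ent (conjOp A D) x x' = ∑ y, entXY A y x * D y * entXY A y x' := by
  unfold ent
  rw [conjOp_apply]
  refine Finset.sum_congr rfl fun y _ => ?_
  rw [mul_assoc]
  rfl

/-- **Block reads ⇒ block-diagonal majorant of Q′ᵀDQ′**: if every averaging site y reads only the block β(y)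
(A(y, x) ≠ 0 ⇒ blk x = β y), |D(y)| ≦ d(β y), the rows of A have ℓ¹ norm ≦ r(β y) and its columns ℓ¹ norm ≦ c(blk x)
(d, r ≧ 0), then Q′ᵀDQ′ has the block majorant K(a, b) = 1_{a = b}·d(a)c(a)r(a) (print: block Δ(y) = B^j(y),
d ∝ a_j(L^jη)^{d−2}, so that K(a, a)(L^{j_a}η)² = O(a_j) — sizes NOT asserted).
[cite: Balaban1985BackgroundPropagators, (3.24) p.394, (3.88) p.409] -/
theorem hasMajorant_conjOp (blk : X → G.Site) (β : Y → G.Site) (A : (X → ℝ) →ₗ[ℝ] (Y → ℝ)) (D : Y → ℝ)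
    (d r c : G.Site → ℝ) (hd0 : ∀ a, 0 ≤ d a) (hr0 : ∀ a, 0 ≤ r a)
    (hread : ∀ y x, entXY A y x ≠ 0 → blk x = β y) (hD : ∀ y, |D y| ≤ d (β y))
    (hr : ∀ y, ∑ x, |entXY A y x| ≤ r (β y)) (hc : ∀ x, ∑ y, |entXY A y x| ≤ c (blk x)) :
    HasMajorant blk (conjOp A D) (fun a b => if a = b then d a * c a * r a else 0) := by
  refine hasMajorant_of_rowBlockSum_le blk fun x y' => ?_
  have hent : ∀ x', |ent (conjOp A D) x x'| ≤ ∑ y, |entXY A y x| * |D y| * |entXY A y x'| := fun x' => by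
    rw [ent_conjOp]
    refine (Finset.abs_sum_le_sum_abs _ _).trans (le_of_eq (Finset.sum_congr rfl fun y _ => ?_))
    rw [abs_mul, abs_mul]
  by_cases hy : blk x = y'
  · rw [if_pos hy]
    calc ∑ x' ∈ Finset.univ.filter (fun x' => blk x' = y'), |ent (conjOp A D) x x'|
        ≤ ∑ x', |ent (conjOp A D) x x'| :=
          Finset.sum_le_sum_of_subset_of_nonneg (Finset.filter_subset _ _) fun _ _ _ => abs_nonneg _
      _ ≤ ∑ x', ∑ y, |entXY A y x| * |D y| * |entXY A y x'| := Finset.sum_le_sum fun x' _ => hent x'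
      _ = ∑ y, |entXY A y x| * (|D y| * ∑ x', |entXY A y x'|) := by
          rw [Finset.sum_comm]
          refine Finset.sum_congr rfl fun y _ => ?_
          rw [Finset.mul_sum, Finset.mul_sum]
          exact Finset.sum_congr rfl fun x' _ => by ring
      _ ≤ ∑ y, |entXY A y x| * (d (blk x) * r (blk x)) := by
          refine Finset.sum_le_sum fun y _ => ?_
          by_cases hA : entXY A y x = 0
          · rw [hA, abs_zero, zero_mul, zero_mul]
          · rw [hread y x hA]
            exact mul_le_mul_of_nonneg_left
              (mul_le_mul (hD y) (hr y) (Finset.sum_nonneg fun _ _ => abs_nonneg _) (hd0 _)) (abs_nonneg _)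
      _ = (∑ y, |entXY A y x|) * (d (blk x) * r (blk x)) := by rw [Finset.sum_mul]
      _ ≤ c (blk x) * (d (blk x) * r (blk x)) :=
          mul_le_mul_of_nonneg_right (hc x) (mul_nonneg (hd0 _) (hr0 _))
      _ = d (blk x) * c (blk x) * r (blk x) := by ring
  · rw [if_neg hy]
    refine (Finset.sum_eq_zero fun x' hx' => ?_).le
    simp only [Finset.mem_filter, Finset.mem_univ, true_and] at hx'
    rw [abs_eq_zero, ent_conjOp]
    refine Finset.sum_eq_zero fun y _ => ?_
    by_cases hA : entXY A y x = 0
    · rw [hA, zero_mul, zero_mul]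
    · by_cases hA' : entXY A y x' = 0
      · rw [hA', mul_zero]
      · exact absurd (((hread y x hA).trans (hread y x' hA').symm).trans hx') hy

end Conj

/-! ## §7  Bundled: the five Q-hypotheses of the lineage for Q = Q′ᵀDQ′ with block reads -/

section BundledConj

variable {g : B9.Geometry} [Fintype g.Site] [DecidableEq g.Site] {R : ℝ} {H : Prop}
  {St Cp ι Y : Type} [Fintype St] [Fintype Cp] [DecidableEq St] [DecidableEq Cp] [Fintype Y]

/-- **The Q-data of the lineage for Q := Q′ᵀDQ′** (`hQ`, `hKQ`, `hlocQ`, `hrowQ`, `hcolQ` with the block-DIAGONAL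
K_{Q,□}(a, b) = ω_□(a, b)·1_{a=b}·d(a)c(a)r(a), κ_Q := ω₀k): from block reads of the averaging operator A = Q′
(`hread`), |D| ≦ d, row / column ℓ¹ bounds r, c of A, the diagonal size bound d(a)c(a)r(a)(L^{j_a}η)² ≦ k (print:
O(a_j) = O(1), NOT asserted), d(a, a) ≦ ρ, and the oscillation data of `commData_of_osc`.
[cite: Balaban1985BackgroundPropagators, (3.24) p.394, (3.88) p.409 (second display line)] -/
theorem commData_of_conj (blk : St × Cp → g.Site) (β : Y → g.Site) (A : (St × Cp → ℝ) →ₗ[ℝ] (Y → ℝ))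
    (D : Y → ℝ) (d r c : g.Site → ℝ) (hd0 : ∀ a, 0 ≤ d a) (hr0 : ∀ a, 0 ≤ r a) (hc0 : ∀ a, 0 ≤ c a)
    (hread : ∀ y p, entXY A y p ≠ 0 → blk p = β y) (hD : ∀ y, |D y| ≤ d (β y))
    (hr : ∀ y, ∑ p, |entXY A y p| ≤ r (β y)) (hc : ∀ p, ∑ y, |entXY A y p| ≤ c (blk p))
    (ρ : ℝ) (hρ : ∀ a : g.Site, g.dist a a ≤ ρ) (k : ℝ) (hk : ∀ a : g.Site, d a * c a * r a * g.len a ^ 2 ≤ k)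
    (hs : ι → St → ℝ) (S' : ι → Finset g.Site) (ω : ι → g.Site → g.Site → ℝ) (ω₀ : ℝ)
    (hω0 : ∀ i a b, 0 ≤ ω i a b) (hωb : ∀ i a b, ω i a b ≤ ω₀)
    (hωS : ∀ i a b, ω i a b ≠ 0 → a ∈ S' i ∧ b ∈ S' i)
    (hω : ∀ i (p q : St × Cp), ent (conjOp A D) p q ≠ 0 → |hs i p.1 - hs i q.1| ≤ ω i (blk p) (blk q)) :
    (∀ i, HasMajorant (g := toB6 g R H) blk
        (mulOp (hs i ∘ Prod.fst) * conjOp A D - conjOp A D * mulOp (hs i ∘ Prod.fst))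
        (fun a b : g.Site => ω i a b * (if a = b then d a * c a * r a else 0)))
    ∧ (∀ i (a b : g.Site), 0 ≤ ω i a b * (if a = b then d a * c a * r a else 0))
    ∧ (∀ i (a y'' : g.Site), ω i a y'' * (if a = y'' then d a * c a * r a else 0) ≠ 0 → g.dist a y'' ≤ ρ)
    ∧ (∀ i (a : g.Site), ∑ y'' : g.Site, ω i a y'' * (if a = y'' then d a * c a * r a else 0) * g.len y'' ^ 2
        ≤ if a ∈ S' i then ω₀ * k else 0)
    ∧ (∀ i (b : g.Site), (∑ y'' : g.Site, ω i y'' b * (if y'' = b then d y'' * c y'' * r y'' else 0)) * g.len b ^ 2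
        ≤ if b ∈ S' i then ω₀ * k else 0) := by
  have hT : HasMajorant (g := toB6 g R H) blk (conjOp A D)
      (fun a b : g.Site => if a = b then d a * c a * r a else 0) :=
    @hasMajorant_conjOp (toB6 g R H) (inferInstanceAs (DecidableEq g.Site)) (St × Cp) _ _ Y _ blk β A D d r c
      hd0 hr0 hread hD hr hc
  have hK : ∀ a b : g.Site, 0 ≤ (if a = b then d a * c a * r a else 0) := fun a b => by
    split_ifs
    · exact mul_nonneg (mul_nonneg (hd0 a) (hc0 a)) (hr0 a)
    · exact le_rfl
  have hloc : ∀ a b : g.Site, (if a = b then d a * c a * r a else 0) ≠ 0 → g.dist a b ≤ ρ := fun a b hab => by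
    by_cases h : a = b
    · rw [← h]; exact hρ a
    · exact absurd (if_neg h) hab
  have hrow : ∀ a : g.Site, ∑ b : g.Site, (if a = b then d a * c a * r a else 0) * g.len b ^ 2 ≤ k := fun a => by
    rw [Finset.sum_eq_single a (fun b _ hb => by rw [if_neg (Ne.symm hb), zero_mul]) (fun h => absurd (Finset.mem_univ a) h),
      if_pos rfl]
    exact hk a
  have hcol : ∀ b : g.Site, (∑ a : g.Site, (if a = b then d a * c a * r a else 0)) * g.len b ^ 2 ≤ k := fun b => by
    rw [Finset.sum_eq_single b (fun a _ ha => by rw [if_neg ha]) (fun h => absurd (Finset.mem_univ b) h), if_pos rfl]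
    exact hk b
  exact commData_of_osc blk (conjOp A D) _ hT hK ρ hloc k hrow hcol hs S' ω ω₀ hω0 hωb hωS hω

end BundledConj

/-! ## §8  Block reads ⇒ Q couples only points of ONE block: the oscillation hypothesis `hω` from the
within-block oscillation of h_□ (v3, append-only) -/

section OscConj

variable {Y : Type} [Fintype Y]

omit [DecidableEq G.Site] [Fintype X] in
/-- **Q′ᵀDQ′ with block reads is block-diagonal at the level of matrix entries**: Q(x, x′) ≠ 0 forces
blk x = blk x′ (both are the block β(y) of an averaging site y reading x and x′). [cite: Balaban1985BackgroundPropagators, (3.19) p.393, (3.24) p.394] -/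
theorem blk_eq_of_ent_conjOp_ne (blk : X → G.Site) (β : Y → G.Site) (A : (X → ℝ) →ₗ[ℝ] (Y → ℝ)) (D : Y → ℝ)
    (hread : ∀ y x, entXY A y x ≠ 0 → blk x = β y) {x x' : X} (hne : ent (conjOp A D) x x' ≠ 0) :
    blk x = blk x' := by
  by_contra hxx
  apply hne
  rw [ent_conjOp]
  refine Finset.sum_eq_zero fun y _ => ?_
  by_cases hA : entXY A y x = 0
  · rw [hA, zero_mul, zero_mul]
  · by_cases hA' : entXY A y x' = 0
    · rw [hA', mul_zero]
    · exact absurd ((hread y x hA).trans (hread y x' hA').symm) hxx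

omit [Fintype X] in
/-- **The oscillation hypothesis `hω` of `commData_of_osc` / `hasMajorant_comm_mulOp` for Q = Q′ᵀDQ′ with block
reads, from a WITHIN-BLOCK oscillation bound of h**: if |h(x) − h(x′)| ≦ o(blk x) whenever blk x = blk x′, then
|h(x) − h(x′)| ≦ ω(blk x, blk x′) on every Q-coupled pair with the DIAGONAL ω(a, b) = 1_{a=b}·o(a) (print: h_□
varies on scale ML^jη and a block Δ(y) = B^j(y) has diameter ~ L^jη, so o = O(M^{−1}) — NOT asserted).
[cite: Balaban1985BackgroundPropagators, (3.88) p.409 (second display line); Balaban1984PropagatorsII, (2.44) p.230] -/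
theorem osc_of_blockReads (blk : X → G.Site) (β : Y → G.Site) (A : (X → ℝ) →ₗ[ℝ] (Y → ℝ)) (D : Y → ℝ)
    (hread : ∀ y x, entXY A y x ≠ 0 → blk x = β y) (h : X → ℝ) (o : G.Site → ℝ)
    (hosc : ∀ x x', blk x = blk x' → |h x - h x'| ≤ o (blk x)) :
    ∀ x x', ent (conjOp A D) x x' ≠ 0 → |h x - h x'| ≤ (if blk x = blk x' then o (blk x) else 0) := by
  intro x x' hne
  have hb : blk x = blk x' := blk_eq_of_ent_conjOp_ne blk β A D hread hne
  rw [if_pos hb]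
  exact hosc x x' hb

end OscConj

/-! ## §9  Bundled: the five Q-hypotheses for Q = Q′ᵀDQ′ from block reads + within-block oscillation -/

section BundledOsc

variable {g : B9.Geometry} [Fintype g.Site] [DecidableEq g.Site] {R : ℝ} {H : Prop}
  {St Cp ι Y : Type} [Fintype St] [Fintype Cp] [DecidableEq St] [DecidableEq Cp] [Fintype Y]

/-- **The Q-data of the lineage for Q := Q′ᵀDQ′, all inputs primitive**: block reads + |D| ≦ d + row / column ℓ¹
bounds r, c + the diagonal size k + d(a, a) ≦ ρ (as in `commData_of_conj`), and per cube □ = i a WITHIN-BLOCK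
oscillation bound o_□(a) ∈ [0, ω₀] of h_□, vanishing for blocks a ∉ S′_□ (`ho0`, `hob`, `hoS`, `hosc`).  Output:
the five binders hQ / hKQ / hlocQ / hrowQ / hcolQ of `thm37_entry*_of_342_lattice_of_387[_st]` with
K_{Q,□}(a, b) = (1_{a=b}o_□(a))·(1_{a=b}d(a)c(a)r(a)) and κ_Q := ω₀k.  Print's sizes (o = O(M^{−1}), dcr(L^jη)² =
O(a_j)) are NOT asserted. [cite: Balaban1985BackgroundPropagators, (3.24) p.394, (3.88)–(3.89) p.409] -/
theorem commData_of_conj_osc (blk : St × Cp → g.Site) (β : Y → g.Site) (A : (St × Cp → ℝ) →ₗ[ℝ] (Y → ℝ))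
    (D : Y → ℝ) (d r c : g.Site → ℝ) (hd0 : ∀ a, 0 ≤ d a) (hr0 : ∀ a, 0 ≤ r a) (hc0 : ∀ a, 0 ≤ c a)
    (hread : ∀ y p, entXY A y p ≠ 0 → blk p = β y) (hD : ∀ y, |D y| ≤ d (β y))
    (hr : ∀ y, ∑ p, |entXY A y p| ≤ r (β y)) (hc : ∀ p, ∑ y, |entXY A y p| ≤ c (blk p))
    (ρ : ℝ) (hρ : ∀ a : g.Site, g.dist a a ≤ ρ) (k : ℝ) (hk : ∀ a : g.Site, d a * c a * r a * g.len a ^ 2 ≤ k)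
    (hs : ι → St → ℝ) (S' : ι → Finset g.Site) (o : ι → g.Site → ℝ) (ω₀ : ℝ)
    (ho0 : ∀ i a, 0 ≤ o i a) (hob : ∀ i a, o i a ≤ ω₀) (hoS : ∀ i a, o i a ≠ 0 → a ∈ S' i)
    (hosc : ∀ i (p q : St × Cp), blk p = blk q → |hs i p.1 - hs i q.1| ≤ o i (blk p)) :
    (∀ i, HasMajorant (g := toB6 g R H) blk
        (mulOp (hs i ∘ Prod.fst) * conjOp A D - conjOp A D * mulOp (hs i ∘ Prod.fst))
        (fun a b : g.Site => (if a = b then o i a else 0) * (if a = b then d a * c a * r a else 0)))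
    ∧ (∀ i (a b : g.Site), 0 ≤ (if a = b then o i a else 0) * (if a = b then d a * c a * r a else 0))
    ∧ (∀ i (a y'' : g.Site),
        (if a = y'' then o i a else 0) * (if a = y'' then d a * c a * r a else 0) ≠ 0 → g.dist a y'' ≤ ρ)
    ∧ (∀ i (a : g.Site), ∑ y'' : g.Site,
        (if a = y'' then o i a else 0) * (if a = y'' then d a * c a * r a else 0) * g.len y'' ^ 2
        ≤ if a ∈ S' i then ω₀ * k else 0)
    ∧ (∀ i (b : g.Site), (∑ y'' : g.Site,
        (if y'' = b then o i y'' else 0) * (if y'' = b then d y'' * c y'' * r y'' else 0)) * g.len b ^ 2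
        ≤ if b ∈ S' i then ω₀ * k else 0) := by
  have hω0' : ∀ i (a b : g.Site), 0 ≤ (if a = b then o i a else 0) := fun i a b => by
    split_ifs
    · exact ho0 i a
    · exact le_rfl
  have hωb' : ∀ i (a b : g.Site), (if a = b then o i a else 0) ≤ ω₀ := fun i a b => by
    split_ifs
    · exact hob i a
    · exact (ho0 i a).trans (hob i a)
  have hωS' : ∀ i (a b : g.Site), (if a = b then o i a else 0) ≠ 0 → a ∈ S' i ∧ b ∈ S' i := fun i a b hab => by
    by_cases h : a = b
    · rw [if_pos h] at hab
      exact ⟨hoS i a hab, h ▸ hoS i a hab⟩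
    · exact absurd (if_neg h) hab
  have hω' : ∀ i (p q : St × Cp), ent (conjOp A D) p q ≠ 0 →
      |hs i p.1 - hs i q.1| ≤ (if blk p = blk q then o i (blk p) else 0) := fun i =>
    @osc_of_blockReads (toB6 g R H) (inferInstanceAs (DecidableEq g.Site)) (St × Cp) _ Y _ blk β A D hread
      (hs i ∘ Prod.fst) (o i) (hosc i)
  exact commData_of_conj blk β A D d r c hd0 hr0 hc0 hread hD hr hc ρ hρ k hk hs S' (fun i a b =>
    if a = b then o i a else 0) ω₀ hω0' hωb' hωS' hω'

end BundledOsc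

/-! ## §10  Within-block oscillation of h_□ from the per-bond difference bound and block connectivity (v4)

§8–§9 reduce the Q-part oscillation input to a WITHIN-BLOCK oscillation bound o_□ of h_□.  Here o_□ is reduced to
the same primitive size that drives the T-part of (3.88) in the lineage (`B9Thm37GlueSz`, sizes θ_□): a per-bond
difference bound θ of h_□ (print: h_□ of (1.118)/(2.36) of [4] varies on the scale of the cubes of 𝒟_j)
telescoped along a chain of ≦ P bonds inside the block (print: a block B^j(y) has side L^j η-bonds) —
`osc_of_linked`, o_□(a) = 1_{a∈S′_□}·Pθ.  The chain notion `Linked` is the cell's; θ, P, the connectivity `hconn`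
and the jump location `hsupp` are HYPOTHESES; nothing of print is asserted. -/

section Oscillation

variable {St Bd Cp : Type}

/-- `Linked src tgt E n x x′`: the point x is joined to x′ by a chain of n bonds taken from the bond set E, each
traversed in either direction (the cell's typing of "x, x′ lie in one block, which is connected"). [folklore] -/
def Linked (src tgt : Bd → St) (E : Bd → Prop) : ℕ → St → St → Prop
  | 0, x, x' => x = x'
  | n + 1, x, x' => ∃ b, E b ∧ ((src b = x ∧ Linked src tgt E n (tgt b) x') ∨ (tgt b = x ∧ Linked src tgt E n (src b) x'))

/-- Telescoping along a chain: a per-bond difference bound θ on the bonds of E gives |h(x) − h(x′)| ≦ nθ for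
points linked by n bonds of E. [folklore] -/
theorem abs_sub_le_of_linked (src tgt : Bd → St) (E : Bd → Prop) (h : St → ℝ) (θ : ℝ)
    (hθ : ∀ b, E b → |h (tgt b) - h (src b)| ≤ θ) :
    ∀ (n : ℕ) (x x' : St), Linked src tgt E n x x' → |h x - h x'| ≤ n * θ := by
  intro n
  induction n with
  | zero =>
    intro x x' hl
    have hxx : x = x' := hl
    rw [hxx, sub_self, abs_zero, Nat.cast_zero, zero_mul]
  | succ n ih =>
    intro x x' hl
    obtain ⟨b, hE, hb⟩ := hl
    have step : ∀ u v : St, |h v - h u| ≤ θ → Linked src tgt E n v x' → |h u - h x'| ≤ (n + 1 : ℕ) * θ := by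
      intro u v huv hl'
      calc |h u - h x'| = |(h u - h v) + (h v - h x')| := by ring_nf
        _ ≤ |h u - h v| + |h v - h x'| := abs_add_le _ _
        _ ≤ θ + n * θ := add_le_add (by rw [abs_sub_comm]; exact huv) (ih v x' hl')
        _ = (n + 1 : ℕ) * θ := by push_cast; ring
    rcases hb with ⟨hs, hl'⟩ | ⟨ht, hl'⟩
    · rw [← hs]
      exact step (src b) (tgt b) (hθ b hE) hl'
    · rw [← ht]
      refine step (tgt b) (src b) ?_ hl'
      rw [abs_sub_comm]
      exact hθ b hE

/-- Along a chain of bonds across which h does not jump, h is constant. [folklore] -/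
theorem eq_of_linked (src tgt : Bd → St) (E : Bd → Prop) (h : St → ℝ)
    (hE : ∀ b, E b → h (tgt b) = h (src b)) {n : ℕ} {x x' : St} (hl : Linked src tgt E n x x') :
    h x = h x' := by
  have h0 : |h x - h x'| ≤ n * 0 :=
    abs_sub_le_of_linked src tgt E h 0 (fun b hb => by rw [hE b hb, sub_self, abs_zero]) n x x' hl
  rw [mul_zero] at h0
  exact sub_eq_zero.mp (abs_nonpos_iff.mp h0)

/-- **Within-block oscillation of h_□ from a per-bond difference bound and block connectivity**: if every bond
difference of h is ≦ θ (`hθ`), h jumps only across bonds whose source blocks lie in S′ (`hsupp`), and any two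
points of one block are linked by ≦ P bonds whose sources stay in that block (`hconn`), then
|h(p.1) − h(q.1)| ≦ 1_{blk p ∈ S′}·Pθ whenever blk p = blk q — the located within-block oscillation bound
(the inputs `hosc`/`hoS` of `commData_of_conj_osc` with o_□(a) = 1_{a∈S′}Pθ).  Print: θ = O((ML^jη)^{−1})·η-bond,
P = O(L^j) bonds across a block B^j(y), Pθ = O(M^{−1}) — NOT asserted. [folklore] -/
theorem osc_of_linked (S' : Finset G.Site) (blk : St × Cp → G.Site) (src tgt : Bd → St) (h : St → ℝ) (θ : ℝ)
    (P : ℕ) (hθ0 : 0 ≤ θ) (hθ : ∀ b, |h (tgt b) - h (src b)| ≤ θ)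
    (hsupp : ∀ b, h (tgt b) ≠ h (src b) → ∀ i, blk (src b, i) ∈ S')
    (hconn : ∀ p q : St × Cp, blk p = blk q →
      ∃ n ≤ P, Linked src tgt (fun b => ∀ i, blk (src b, i) = blk p) n p.1 q.1) :
    ∀ p q : St × Cp, blk p = blk q → |h p.1 - h q.1| ≤ (if blk p ∈ S' then (P : ℝ) * θ else 0) := by
  intro p q hpq
  obtain ⟨n, hn, hl⟩ := hconn p q hpq
  by_cases hS : blk p ∈ S'
  · rw [if_pos hS]
    calc |h p.1 - h q.1| ≤ n * θ := abs_sub_le_of_linked src tgt _ h θ (fun b _ => hθ b) n p.1 q.1 hl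
      _ ≤ P * θ := mul_le_mul_of_nonneg_right (Nat.cast_le.mpr hn) hθ0
  · rw [if_neg hS]
    have hE : ∀ b, (∀ i, blk (src b, i) = blk p) → h (tgt b) = h (src b) := by
      intro b hb
      by_contra hne
      exact hS ((hb p.2) ▸ hsupp b hne p.2)
    rw [eq_of_linked src tgt _ h hE hl, sub_self, abs_zero]


end Oscillation

/-! ## §11  The ℓ¹ sizes r, c of the averaging matrix Q′ from a pointwise bound and block reads (v4)

`hasMajorant_conjOp` / `commData_of_conj[_osc]` take row and column ℓ¹ bounds r, c of A = Q′ as binders.  With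
the block reads of (3.19) they follow from a POINTWISE bound |A(y, x)| ≦ w(β y) and two cardinalities: ≦ n_X
points per block (rows) and ≦ n_Y averaging sites per block (columns).  Print ((3.19), p. 393): A(y, x) =
L^{−jd}R(U(Γ^{(j)}_{y,x})) for x ∈ B^j(y), so w = L^{−jd}, n_X = L^{jd}, n_Y = 1, r = 1, c = L^{−jd} — NOT asserted
(binders w, n_X, n_Y).  Stated for a bare entry function A : Y → X → ℝ (instantiate with `entXY Q′`). -/

section PointwiseQ

variable {Y : Type} [Fintype Y]

omit [DecidableEq X] [Fintype Y] in
/-- **Row ℓ¹ bound of the averaging matrix from a pointwise bound and block reads**: if |A(y, x)| ≦ w(β y),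
A(y, x) ≠ 0 only for x in the block β(y) (`hread`), and a block holds ≦ n_X points, then
Σ_x |A(y, x)| ≦ n_X(β y)·w(β y) (print, (3.19): w = L^{−jd}, n_X = L^{jd} points of B^j(y), so r = 1 — NOT
asserted; the binder `hr` of `hasMajorant_conjOp` with A := `entXY Q′`). [folklore] -/
theorem rowSum_le_of_pointwise (blk : X → G.Site) (β : Y → G.Site) (A : Y → X → ℝ) (w nX : G.Site → ℝ)
    (hw0 : ∀ a, 0 ≤ w a) (hA : ∀ y x, |A y x| ≤ w (β y)) (hread : ∀ y x, A y x ≠ 0 → blk x = β y)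
    (hcard : ∀ a, ((univ.filter fun x => blk x = a).card : ℝ) ≤ nX a) (y : Y) :
    ∑ x, |A y x| ≤ nX (β y) * w (β y) := by
  have hsplit : ∑ x, |A y x| = ∑ x ∈ univ.filter (fun x => blk x = β y), |A y x| := by
    rw [sum_filter]
    refine sum_congr rfl fun x _ => ?_
    by_cases hx : blk x = β y
    · rw [if_pos hx]
    · rw [if_neg hx]
      by_cases hz : A y x = 0
      · rw [hz, abs_zero]
      · exact absurd (hread y x hz) hx
  rw [hsplit]
  calc ∑ x ∈ univ.filter (fun x => blk x = β y), |A y x|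
      ≤ ∑ x ∈ univ.filter (fun x => blk x = β y), w (β y) := sum_le_sum fun x _ => hA y x
    _ = ((univ.filter fun x => blk x = β y).card : ℝ) * w (β y) := by rw [sum_const, nsmul_eq_mul]
    _ ≤ nX (β y) * w (β y) := mul_le_mul_of_nonneg_right (hcard _) (hw0 _)

omit [Fintype X] [DecidableEq X] in
/-- **Column ℓ¹ bound**: with the same pointwise bound and block reads, if ≦ n_Y averaging sites read the block
of x, then Σ_y |A(y, x)| ≦ n_Y(blk x)·w(blk x) (print: each x ∈ B^j(Λ_j) is read by exactly one y ∈ Λ_j, so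
c = L^{−jd} — NOT asserted; the binder `hc` of `hasMajorant_conjOp` with A := `entXY Q′`). [folklore] -/
theorem colSum_le_of_pointwise (blk : X → G.Site) (β : Y → G.Site) (A : Y → X → ℝ) (w nY : G.Site → ℝ)
    (hw0 : ∀ a, 0 ≤ w a) (hA : ∀ y x, |A y x| ≤ w (β y)) (hread : ∀ y x, A y x ≠ 0 → blk x = β y)
    (hcard : ∀ a, ((univ.filter fun y => β y = a).card : ℝ) ≤ nY a) (x : X) :
    ∑ y, |A y x| ≤ nY (blk x) * w (blk x) := by
  have hsplit : ∑ y, |A y x| = ∑ y ∈ univ.filter (fun y => β y = blk x), |A y x| := by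
    rw [sum_filter]
    refine sum_congr rfl fun y _ => ?_
    by_cases hy : β y = blk x
    · rw [if_pos hy]
    · rw [if_neg hy]
      by_cases hz : A y x = 0
      · rw [hz, abs_zero]
      · exact absurd (hread y x hz).symm hy
  rw [hsplit]
  calc ∑ y ∈ univ.filter (fun y => β y = blk x), |A y x|
      ≤ ∑ y ∈ univ.filter (fun y => β y = blk x), w (blk x) :=
        sum_le_sum fun y hy => by
          have hβ : β y = blk x := (mem_filter.mp hy).2
          rw [← hβ]
          exact hA y x
    _ = ((univ.filter fun y => β y = blk x).card : ℝ) * w (blk x) := by rw [sum_const, nsmul_eq_mul]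
    _ ≤ nY (blk x) * w (blk x) := mul_le_mul_of_nonneg_right (hcard _) (hw0 _)


end PointwiseQ

end Literature.MathematicalPhysics.QuantumFieldTheory.Balaban1983to89.B9Thm37GlueQ
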